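import Literature.MathematicalPhysics.QuantumLattice.LayeredXYMerminWagnerCeiling
import Literature.MathematicalPhysics.QuantumLattice.AnisotropicHeisenbergGaussianDomination
import Mathlib.NumberTheory.Harmonic.Bounds
import HarnessLib

/-!
# The layered Heisenberg antiferromagnet (weakly coupled planes, Kennedy–Lieb–Shastry's model (5)): a Mermin–Wagner
# CEILING on the sourced staggered magnetisation in EVERY direction, `m_s² ≤ β S² [2S²(16 ΣK_∥/H_R + 8|K_⊥|R²) + 4S|B|R²]`
# uniformly in the volume — the Néel order parameter of weakly coupled Heisenberg layers is `O(√(β/log(1/K_⊥)))`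

Topic `Literature/MathematicalPhysics/QuantumLattice` (family `hubbard`; sequel of `LayeredXYMerminWagnerCeiling` — the same
one-layer test function and layer geometry, now for the `SU(2)`-invariant model — and of the anisotropic-coupling Heisenberg
files `AnisotropicHeisenberg*` (`heisAnisoTorus L n K = Σ_x Σ_i K_i 𝐒_x·𝐒_{x+e_i}`, Kennedy–Lieb–Shastry's model (5))).

THE QUESTION. The tree PROVES, by reflection positivity and Gaussian domination, that the LAYERED Heisenberg antiferromagnet —
spin-`S` square-lattice antiferromagnets stacked with interlayer coupling `r`, `K = (1, 1, r)`, `0 < r ≤ 1` — HAS Néel order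
at low temperature (large spin `layeredHeis_neelLRO_thermal_largeSpin`, `layeredHeis_thermalNeelOrderParameter_ge`; spin one
`layeredHeis_neelLRO_thermal_spinOne_all`; by certificate `layeredHeis_neelLRO_thermal_of_certificate`; ground states
`layeredHeis_neelLRO_of_certificate`, `layeredHeis_planar_neelOrderParameter_ge`): a FLOOR on the Néel order parameter.
This file PROVES the complementary CEILING — Mermin–Wagner's argument [cite: MerminWagnerPRL1966, pp. 1133–1135] ("absence
of ferromagnetism OR ANTIFERROMAGNETISM"), run with Klein–Landau–Shucker's one-layer cutoff [cite: KleinLandauShucker1981]: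
the staggered magnetisation that a staggered field `B` induces, IN ANY SPIN DIRECTION `α` (the model is isotropic: for a
planar direction the rotation generator is `Σ f_z Sᶻ_z`, for the axial one `Σ f_z Sˣ_z`), is bounded uniformly in the volume
by `β` times an in-plane cost `~ ΣK_∥/log R` plus an interlayer cost `~ |K_⊥|R²`, plus a source cost `~ |B|R²`; for the
infinitesimal-field Néel states the source cost drops out and, optimising `R`, the Néel order parameter of weakly coupled
layers is `O(√(β S⁴(ΣK_∥+1)/log(1/|K_⊥|)))` at every fixed temperature: a Néel moment of size `m₀` can only exist at
`β ≳ m₀² log(1/|K_⊥|)/S⁴` — the rigorous one-sided content of the quasi-two-dimensional estimate `T_N ≲ J S²/log(J/J_⊥)`.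
(For `K_⊥ = 0` and `R → ∞` it is Mermin–Wagner's two-dimensional theorem for the antiferromagnet.) The couplings enter only
through `|K_i|`, so the ferromagnet and any sign pattern are covered, and the staggering `σ` is arbitrary (`σ = 0`: uniform
field and magnetisation).

## Contents (everything PROVED, standard axioms; no definition, no named fact)

* §H1 **Mermin–Wagner for the Heisenberg model with arbitrary bond weights**, any torus `(ℤ/Lℤ)^d`, any field profile `b`,
  any direction: the double commutators `[C,[K,C]] = −Σ_e w_e (f_x−f_y)²(B⁰_e+B¹_e) + Σ_x b_x f_x² S^α_x` for
  `K = H_w − Σ_x b_x S^α_x`, `α ∈ {x,y}`, `C = Σ_z f_z Sᶻ_z` (`doubleComm_heisWeighted_with_planarField`) and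
  `= −Σ_e w_e (f_x−f_y)²(B¹_e+B²_e) + Σ_x b_x f_x² Sᶻ_x` for `α = z`, `C = Σ_z f_z Sˣ_z` (`doubleComm_heisWeighted_with_axialField`),
  and the local bound, every `α`, real `f` with `f_o = 1`:
  `(Re⟨S^α_o⟩_{β,K})² ≤ β S² (2S² Σ_e |w_e|(f_x−f_y)² + S Σ_x |b_x| f_x²)` (`sq_re_gibbsState_siteSpin_le_heisWeighted`).
* §H2 **the four estimates of the one-layer harmonic test function** `f(x) = [x_{last} = o_{last}]·g_R(dist(x,o))`,
  `g_R(r) = (Σ_{r≤k<R} 1/(k+1))/H_R`, on `(ℤ/Lℤ)^{m+1}`, `m ∈ {1,2}`, `L ≥ 2`, `R ≥ 1` (`layerHarmonicProfile_estimates`):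
  `f_o = 1`, `Σ_x (f_x − f_{x+e_j})² ≤ 16/H_R` (in-plane `j`), `Σ_x (f_x − f_{x+e_{last}})² ≤ 8R²`, `Σ_x f_x² ≤ 4R²`
  (from `LayeredXYMerminWagnerCeiling`'s `layerProfile`, `sum_sq_sub_inPlane_le`, `sum_sq_sub_vertical_eq`, `sum_sq_layerProfile_eq`).
* §H3 **THE LAYERED CEILING** (`sq_re_gibbsState_siteSpin_le_layeredHeis`): on `(ℤ/Lℤ)^{m+1}`, `m ∈ {1,2}`, `L ≥ 3`, for
  `K = H_K − B·O^α_σ` (`H_K = heisAnisoTorus L n K`, `O^α_σ = Σ_x (−1)^{σ(x)} S^α_x = XXZKT.stagSpin n σ α`, any `α`, any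
  `σ`), `β ≥ 0`, every `R ≥ 1`, every site `o`:
  `(Re⟨S^α_o⟩_β)² ≤ β S² (2S² (16 (Σ_{j<m}|K_j|)/H_R + 8|K_m| R²) + S |B| · 4R²)`, `H_R = Σ_{k<R} 1/(k+1)`, uniformly in
  `L`; the three-dimensional form `sq_re_gibbsState_siteSpin_le_layeredHeis_three` (`K = (K₀, K₁, K_⊥)`).
* §H4 **INFINITE VOLUME** (KT93 (1.8) states over the Néel-sourced Gibbs family
  `k ↦ ⟨·⟩_{β, H_K − B·O^α}` on the even tori `(ℤ/(2k+2)ℤ)^{m+1}`, `O^α = XXZKT.stagSpin n (XXZKT.torusParityExp _ _) α`; the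
  tree's generic `XXZKT.IsSourcedLimit` / `XXZKT.IsInfinitesimalFieldState`): every sourced thermal limit state obeys the
  ceiling at every site (`layeredHeis_sourcedLimit_sq_re_expect_le`), every infinitesimal-field Néel state obeys it WITHOUT
  the source term (`layeredHeis_infinitesimalField_sq_re_expect_le`): `(Re ω̃(S^α_x))² ≤ β S²·2S²(16ΣK_∥/H_R + 8|K_⊥|R²)` for
  every `R ≥ 1` — hence `ω̃(S^α_x) = 0` for decoupled layers (`K_⊥ = 0`,
  `layeredHeis_infinitesimalField_expect_eq_zero_of_decoupled`: the two-dimensional theorem, every direction) and `→ 0`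
  UNIFORMLY as `K_⊥ → 0` at fixed `β`, spin and in-plane budget
  (`layeredHeis_infinitesimalField_sq_re_expect_le_of_interlayer_small`: `∀ ε ∃ δ`); the `1/log` law with Mathlib's
  `log(R+1) ≤ H_R` (`layeredHeis_infinitesimalField_sq_re_expect_le_log`); such states exist
  (`exists_layeredHeis_infinitesimalFieldState`).

WHAT THIS IS NOT: a ceiling only — for `0 < K_⊥ ≤ 1` (and `K_∥ = 1`) the layered antiferromagnet DOES have Néel order at
low temperature (the tree's RP floors above); the two together say that a Néel moment of size `m₀` in weakly coupled
Heisenberg layers requires `β ≳ m₀² log(1/K_⊥)/S⁴` and is guaranteed (large `S`, or `S = 1`, or by certificate) once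
`β ≥ β₀(K_⊥, S)`. No statement about `T_N` itself beyond this one-sided bound, none about the ground state of a single layer
(which IS expected to order for `S ≥ ½` in `d = 2` at `T = 0`), and nothing is claimed about the Hubbard model.

## Mathlib / tree search

REUSED: `doubleComm_xxzBond_rotZ`, `doubleComm_siteSpin_planar_rotZ` (`XXZInfinitesimalFieldStatesMerminWagner`);
`doubleComm_spinDot`, `doubleComm_siteSpin_two`, `mwBondWeight_symm`, `abs_re_gibbsState_mwBondWeight_le`
(`HeisenbergOrderMerminWagner*`); `abs_re_gibbsState_planarBondWeight_le`, `abs_re_gibbsState_field_smul_siteSpin_le`,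
`bogoliubov_inequality`, `IsHermitian.re_gibbsState_doubleComm_nonneg`, `posSemidef_sq_smul_one_sub_siteSpin_sq`,
`sum_smul_siteSpin_isHermitian`; `sum_radial_le_sum_range`, `sum_shell_harmonicProfile_sq_le`, `harmonicProfile_*`,
`one_le_sum_range_one_div_succ`, `sum_range_two_mul_cast_add_one`, `exists_harmonicSum_ge`; `layerProfile`,
`sum_sq_sub_inPlane_le`, `sum_sq_sub_vertical_eq`, `sum_sq_layerProfile_eq`, `sum_edgeFinset_abs_dirCoupling_mul_sq_sub`,
`XXZKT.IsSourcedLimit.sq_re_expect_siteSpinAt_le_of_one_le` (`LayeredXYMerminWagnerCeiling`); `heisWeightedHamiltonian`,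
`heisAnisoTorus`, `heisWeightedHamiltonian_isHermitian`, `heisAnisoTorus_isHermitian` (`AnisotropicHeisenbergGaussianDomination`);
`XXZKT.stagSpin`, `XXZKT.smul_stagSpin_eq_sum_field`, `XXZKT.abs_stagSign`, `XXZKT.torusParityExp`
(`XXZAntiferromagnetThermalSpontaneousOrder`); `XXZKT.IsInfinitesimalFieldState.sq_re_expect_siteSpinAt_le`,
`XXZKT.exists_isInfinitesimalFieldState` (`XXZAntiferromagnetInfiniteVolumeOrder`).
`lean search 'layeredHeis|heisAniso.*Mermin|MerminWagner.*layer'` (2026-08-29): the tree's `layeredHeis_*` are all RP FLOORS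
(`AnisotropicHeisenbergNeelOrder*`, `AnisotropicHeisenbergThermal*`); Mermin–Wagner for the Heisenberg model exists only for
uniform coupling in `d ≤ 2` (`HeisenbergOrderMerminWagner*`, `XXZInfinitesimalFieldStatesMerminWagner`) — no layered ceiling.

## References

* N. D. Mermin, H. Wagner, Phys. Rev. Lett. 17 (1966) 1133–1136, pp. 1133–1135 (Bogoliubov inequality, double commutator,
  "absence of ferromagnetism or antiferromagnetism", the bound `|s| < const (T|ln h|)^{-1/2}` in `d = 2`).
  [cite: MerminWagnerPRL1966, pp. 1133–1135]
* A. Klein, L. J. Landau, D. S. Shucker, J. Stat. Phys. 26 (1981) 505–512 (cutoff functions; layered remark).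
  [cite: KleinLandauShucker1981]
* T. Kennedy, E. H. Lieb, B. S. Shastry, J. Stat. Phys. 53 (1988) 1019–1030, p. 1023 eq. (5) (the layered antiferromagnet,
  couplings `1, 1, r`) and §3. [cite: KLS1988JSP, eq. (5)]
* T. Koma, H. Tasaki, Commun. Math. Phys. 158 (1993) 191, §1 (1.8)–(1.9) (infinitesimal-field states, spontaneous staggered
  magnetisation). [cite: KomaTasaki1993, §1 (1.8)–(1.9)]
* O. Bratteli, D. W. Robinson, Operator Algebras and Quantum Statistical Mechanics I, 2nd ed. (1987), Thm. 2.3.15 (weak-⋆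
  compactness of the state space). [cite: BratteliRobinsonI1987, Thm. 2.3.15]
-/

noncomputable section

namespace Literature.MathematicalPhysics.QuantumLattice

open Finset Matrix Complex _root_.Filter Literature.Probability.LatticeModels
  Literature.MathematicalPhysics.QuantumLattice.SpinOperators
open scoped ComplexOrder MatrixOrder _root_.Topology

/-! ### §H0 The logarithm behind `H_R` -/

section LogAux

/-- `log(R+1) ≤ Σ_{k<R} 1/(k+1)` (Mathlib's `log_add_one_le_harmonic`, cast to the real harmonic sum). [folklore] -/
private theorem log_succ_le_harmonicSum_heis (R : ℕ) : Real.log ((R : ℝ) + 1) ≤ ∑ k ∈ range R, (1 : ℝ) / (k + 1) := by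
  have h := log_add_one_le_harmonic R
  have e : ((harmonic R : ℚ) : ℝ) = ∑ k ∈ range R, (1 : ℝ) / (k + 1) := by
    simp only [harmonic, Rat.cast_sum, Rat.cast_inv, Rat.cast_add, Rat.cast_one, Rat.cast_natCast, Nat.cast_add,
      Nat.cast_one, one_div]
  rw [e] at h
  exact_mod_cast h

end LogAux

/-! ### §H1 Mermin–Wagner for the Heisenberg model with arbitrary bond weights and an arbitrary field profile -/

section HeisWeighted

variable {d : ℕ} (L : ℕ) [NeZero L] (n : ℕ)

/-- `𝐒_x·𝐒_y = B⁰ + B¹ + 1·B²`. [folklore] -/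
private theorem spinDot_eq_xxzBond_one (x y : TorusSite d L) :
    (spinDot n x y : Op (TorusSite d L) (n + 1)) = spinBond n 0 x y + spinBond n 1 x y + (1 : ℂ) • spinBond n 2 x y := by
  rw [spinDot, Fin.sum_univ_three, one_smul]

/-- **Mermin–Wagner's double commutator for the weighted Heisenberg model in a PLANAR field profile**: for
`K = H_w − Σ_x b_x S^α_x` (`H_w = Σ_e w_e 𝐒_x·𝐒_y`, `α ∈ {x, y}`) and `C = Σ_z f_z Sᶻ_z`,
`C(KC − CK) − (KC − CK)C = −Σ_e w_e (f_x − f_y)²(B⁰_e + B¹_e) + Σ_x b_x f_x² S^α_x`. [cite: MerminWagnerPRL1966, p. 1134] -/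
theorem doubleComm_heisWeighted_with_planarField (w : Sym2 (TorusSite d L) → ℝ) (f : TorusSite d L → ℂ)
    (b : TorusSite d L → ℂ) {α : Fin 3} (hα : α ≠ 2) (C K : Op (TorusSite d L) (n + 1))
    (hC : C = ∑ z, f z • siteSpin n z 2) (hK : K = heisWeightedHamiltonian L n w - ∑ x, b x • siteSpin n x α) :
    C * (K * C - C * K) - (K * C - C * K) * C =
      -(∑ e ∈ (torusGraph d L).edgeFinset, ((w e : ℝ) : ℂ) •
          Sym2.lift ⟨fun x y => (f x - f y) ^ 2 • (spinBond n 0 x y + spinBond n 1 x y), planarBondWeight_symm n f⟩ e) +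
        ∑ x, (b x * (f x) ^ 2) • siteSpin n x α := by
  set D : Op (TorusSite d L) (n + 1) →ₗ[ℂ] Op (TorusSite d L) (n + 1) :=
    LinearMap.mulRight ℂ C - LinearMap.mulLeft ℂ C with hD
  have hDapp : ∀ Z : Op (TorusSite d L) (n + 1), D Z = Z * C - C * Z := fun Z => rfl
  have key : C * (K * C - C * K) - (K * C - C * K) * C = -(D (D K)) := by
    simp only [hDapp]
    noncomm_ring
  rw [key, hK]
  simp only [map_sub, map_smul, heisWeightedHamiltonian, map_sum]
  have hedge : ∀ e ∈ (torusGraph d L).edgeFinset, D (D (spinDotSym n e)) =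
      Sym2.lift ⟨fun x y => (f x - f y) ^ 2 • (spinBond n 0 x y + spinBond n 1 x y), planarBondWeight_symm n f⟩ e := by
    intro e _
    induction e using Sym2.ind with
    | h x y =>
      rw [spinDotSym_mk, Sym2.lift_mk, spinDot_eq_xxzBond_one, hDapp, hDapp, doubleComm_xxzBond_rotZ n f 1 x y C hC]
  have hfield : ∀ x ∈ (univ : Finset (TorusSite d L)),
      b x • D (D (siteSpin n x α)) = (b x * (f x) ^ 2) • siteSpin n x α := by
    intro x _
    rw [hDapp, hDapp, doubleComm_siteSpin_planar_rotZ n f x hα C hC, smul_smul]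
  rw [Finset.sum_congr rfl (fun e he => by rw [hedge e he]), Finset.sum_congr rfl hfield]
  abel

/-- **Mermin–Wagner's double commutator for the weighted Heisenberg model in an AXIAL field profile**: for
`K = H_w − Σ_x b_x Sᶻ_x` and `C = Σ_z f_z Sˣ_z`,
`C(KC − CK) − (KC − CK)C = −Σ_e w_e (f_x − f_y)²(B¹_e + B²_e) + Σ_x b_x f_x² Sᶻ_x`. [cite: MerminWagnerPRL1966, p. 1134] -/
theorem doubleComm_heisWeighted_with_axialField (w : Sym2 (TorusSite d L) → ℝ) (f : TorusSite d L → ℂ)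
    (b : TorusSite d L → ℂ) (C K : Op (TorusSite d L) (n + 1))
    (hC : C = ∑ z, f z • siteSpin n z 0) (hK : K = heisWeightedHamiltonian L n w - ∑ x, b x • siteSpin n x 2) :
    C * (K * C - C * K) - (K * C - C * K) * C =
      -(∑ e ∈ (torusGraph d L).edgeFinset, ((w e : ℝ) : ℂ) •
          Sym2.lift ⟨fun x y => (f x - f y) ^ 2 • (spinBond n 1 x y + spinBond n 2 x y), mwBondWeight_symm n f⟩ e) +
        ∑ x, (b x * (f x) ^ 2) • siteSpin n x 2 := by
  set D : Op (TorusSite d L) (n + 1) →ₗ[ℂ] Op (TorusSite d L) (n + 1) :=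
    LinearMap.mulRight ℂ C - LinearMap.mulLeft ℂ C with hD
  have hDapp : ∀ Z : Op (TorusSite d L) (n + 1), D Z = Z * C - C * Z := fun Z => rfl
  have key : C * (K * C - C * K) - (K * C - C * K) * C = -(D (D K)) := by
    simp only [hDapp]
    noncomm_ring
  rw [key, hK]
  simp only [map_sub, map_smul, heisWeightedHamiltonian, map_sum]
  have hedge : ∀ e ∈ (torusGraph d L).edgeFinset, D (D (spinDotSym n e)) =
      Sym2.lift ⟨fun x y => (f x - f y) ^ 2 • (spinBond n 1 x y + spinBond n 2 x y), mwBondWeight_symm n f⟩ e := by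
    intro e _
    induction e using Sym2.ind with
    | h x y =>
      rw [spinDotSym_mk, Sym2.lift_mk, hDapp, hDapp, hC]
      exact doubleComm_spinDot n f x y
  have hfield : ∀ x ∈ (univ : Finset (TorusSite d L)),
      b x • D (D (siteSpin n x 2)) = (b x * (f x) ^ 2) • siteSpin n x 2 := by
    intro x _
    rw [hDapp, hDapp, hC, doubleComm_siteSpin_two n f x, smul_smul]
  rw [Finset.sum_congr rfl (fun e he => by rw [hedge e he]), Finset.sum_congr rfl hfield]
  abel

/-- `K = H_w − Σ_x b_x S^α_x` is Hermitian. [cite: MerminWagnerPRL1966, eq. (1)] -/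
theorem heisWeightedHamiltonian_sub_field_isHermitian (w : Sym2 (TorusSite d L) → ℝ) (b : TorusSite d L → ℝ)
    (α : Fin 3) :
    (heisWeightedHamiltonian L n w - ∑ x, ((b x : ℝ) : ℂ) • siteSpin n x α : Op (TorusSite d L) (n + 1)).IsHermitian :=
  (heisWeightedHamiltonian_isHermitian L n w).sub (sum_smul_siteSpin_isHermitian n b α)

/-- **THE LOCAL MERMIN–WAGNER BOUND FOR THE WEIGHTED HEISENBERG MODEL, ANY FIELD DIRECTION `α`, any field profile, any
real test function** (`SU(2)` symmetry: for `α ∈ {x,y}` the generator `C = Σ f_z Sᶻ_z`, for `α = z` the generator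
`C = Σ f_z Sˣ_z`): `(Re⟨S^α_o⟩_{β, H_w − Σ b_x S^α_x})² ≤ β S² (2S² Σ_e |w_e|(f_x − f_y)² + S Σ_x |b_x| f_x²)`.
[cite: MerminWagnerPRL1966, pp. 1133–1134] -/
theorem sq_re_gibbsState_siteSpin_le_heisWeighted (w : Sym2 (TorusSite d L) → ℝ) (b : TorusSite d L → ℝ)
    (α : Fin 3) {β : ℝ} (hβ : 0 ≤ β) (f : TorusSite d L → ℝ) (o : TorusSite d L) (hfo : f o = 1) :
    (gibbsState β (heisWeightedHamiltonian L n w - ∑ x, ((b x : ℝ) : ℂ) • siteSpin n x α) (siteSpin n o α)).re ^ 2 ≤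
      β * ((n : ℝ) / 2) ^ 2 *
        (2 * ((n : ℝ) / 2) ^ 2 *
            ∑ e ∈ (torusGraph d L).edgeFinset, |w e| * Sym2.lift ⟨fun x y => (f x - f y) ^ 2, fun x y => by ring⟩ e +
          (n : ℝ) / 2 * ∑ x, |b x| * (f x) ^ 2) := by
  set K : Op (TorusSite d L) (n + 1) := heisWeightedHamiltonian L n w - ∑ x, ((b x : ℝ) : ℂ) • siteSpin n x α with hKdef
  set S : ℝ := (n : ℝ) / 2 with hSdef
  set E : ℝ := ∑ e ∈ (torusGraph d L).edgeFinset, |w e| * Sym2.lift ⟨fun x y => (f x - f y) ^ 2, fun x y => by ring⟩ e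
    with hEdef
  set F : ℝ := ∑ x, |b x| * (f x) ^ 2 with hFdef
  have hK : K.IsHermitian := heisWeightedHamiltonian_sub_field_isHermitian L n w b α
  haveI : Nonempty (TensorIndex (TorusSite d L) (n + 1)) := ⟨fun _ => 0⟩
  have hS2re : (((n : ℂ) / 2) ^ 2).re = S ^ 2 := by
    rw [show ((n : ℂ) / 2) ^ 2 = ((((n : ℝ) / 2) ^ 2 : ℝ) : ℂ) by push_cast; ring, Complex.ofReal_re]
  have hSβ : 0 ≤ β * S ^ 2 := mul_nonneg hβ (sq_nonneg _)
  -- the generator `C`, the partner `A` with `CA − AC = u S^α_o`, `‖u‖ = 1`, and the double-commutator bound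
  obtain ⟨C, A, u, hC, hA, hu, hCA, hA2, hDCle⟩ : ∃ (C A : Op (TorusSite d L) (n + 1)) (u : ℂ), C.IsHermitian ∧ A.IsHermitian ∧
      ‖u‖ = 1 ∧ C * A - A * C = u • siteSpin n o α ∧ (gibbsState β K (A * A)).re ≤ S ^ 2 ∧
      (gibbsState β K (C * (K * C - C * K) - (K * C - C * K) * C)).re ≤ 2 * S ^ 2 * E + S * F := by
    by_cases h2 : α = 2
    · subst h2
      refine ⟨∑ z, ((f z : ℝ) : ℂ) • siteSpin n z 0, siteSpin n o 1, I, sum_smul_siteSpin_isHermitian n f 0,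
        siteSpin_isHermitian n o 1, by simp, ?_, ?_, ?_⟩
      · have h1 := siteSpin_one_comm_sub n (fun z => ((f z : ℝ) : ℂ)) o
        rw [← neg_sub, h1, hfo]
        simp
      · have := re_gibbsState_le_of_posSemidef hK β (posSemidef_sq_smul_one_sub_siteSpin_sq n o 1)
        rwa [hS2re] at this
      · have hDC := doubleComm_heisWeighted_with_axialField L n w (fun z => ((f z : ℝ) : ℂ)) (fun x => ((b x : ℝ) : ℂ))
          _ K rfl hKdef
        rw [hDC, map_add, map_neg, map_sum, map_sum, Complex.add_re, Complex.neg_re, Complex.re_sum, Complex.re_sum]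
        refine add_le_add ?_ ?_
        · calc -(∑ e ∈ (torusGraph d L).edgeFinset, (gibbsState β K (((w e : ℝ) : ℂ) • Sym2.lift ⟨fun x y =>
                (((f x : ℝ) : ℂ) - f y) ^ 2 • (spinBond n 1 x y + spinBond n 2 x y),
                  mwBondWeight_symm n fun z => (f z : ℂ)⟩ e)).re)
              ≤ ∑ e ∈ (torusGraph d L).edgeFinset, |w e| * (2 * S ^ 2 *
                Sym2.lift ⟨fun x y => (f x - f y) ^ 2, fun x y => by ring⟩ e) := by
                rw [← Finset.sum_neg_distrib]
                refine Finset.sum_le_sum fun e _ => ?_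
                rw [LinearMap.map_smul, smul_eq_mul, Complex.re_ofReal_mul]
                refine (neg_le_abs _).trans ?_
                rw [abs_mul]
                exact mul_le_mul_of_nonneg_left (abs_re_gibbsState_mwBondWeight_le n hK β f e) (abs_nonneg _)
            _ = 2 * S ^ 2 * E := by
                rw [hEdef, Finset.mul_sum]
                refine Finset.sum_congr rfl fun e _ => ?_
                ring
        · calc ∑ x, (gibbsState β K ((((b x : ℝ) : ℂ) * (((f x : ℝ) : ℂ)) ^ 2) • siteSpin n x 2)).re
              ≤ ∑ x, |(gibbsState β K ((((b x : ℝ) : ℂ) * (((f x : ℝ) : ℂ)) ^ 2) • siteSpin n x 2)).re| :=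
                Finset.sum_le_sum fun x _ => le_abs_self _
            _ ≤ ∑ x, S * (|b x| * (f x) ^ 2) :=
                Finset.sum_le_sum fun x _ => abs_re_gibbsState_field_smul_siteSpin_le n hK β b f x 2
            _ = S * F := by rw [← Finset.mul_sum, hFdef]
    · -- planar direction: generator `Σ f Sᶻ`, partner the other planar component
      obtain ⟨a', u, hu, hCA⟩ : ∃ (a' : Fin 3) (u : ℂ), ‖u‖ = 1 ∧
          (∑ z, ((f z : ℝ) : ℂ) • siteSpin n z 2) * siteSpin n o a' - siteSpin n o a' * (∑ z, ((f z : ℝ) : ℂ) • siteSpin n z 2) =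
            u • siteSpin n o α := by
        have h : α = 0 ∨ α = 1 := by
          fin_cases α
          · exact Or.inl rfl
          · exact Or.inr rfl
          · exact absurd rfl h2
        rcases h with rfl | rfl
        · refine ⟨1, -I, by simp, ?_⟩
          rw [← neg_sub, siteSpin_one_comm_rotZ n (fun z => ((f z : ℝ) : ℂ)) o, hfo]
          simp
        · refine ⟨0, I, by simp, ?_⟩
          rw [← neg_sub, siteSpin_zero_comm_rotZ n (fun z => ((f z : ℝ) : ℂ)) o, hfo]
          simp
      refine ⟨∑ z, ((f z : ℝ) : ℂ) • siteSpin n z 2, siteSpin n o a', u, sum_smul_siteSpin_isHermitian n f 2,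
        siteSpin_isHermitian n o a', hu, hCA, ?_, ?_⟩
      · have := re_gibbsState_le_of_posSemidef hK β (posSemidef_sq_smul_one_sub_siteSpin_sq n o a')
        rwa [hS2re] at this
      · have hDC := doubleComm_heisWeighted_with_planarField L n w (fun z => ((f z : ℝ) : ℂ)) (fun x => ((b x : ℝ) : ℂ))
          h2 _ K rfl hKdef
        rw [hDC, map_add, map_neg, map_sum, map_sum, Complex.add_re, Complex.neg_re, Complex.re_sum, Complex.re_sum]
        refine add_le_add ?_ ?_
        · calc -(∑ e ∈ (torusGraph d L).edgeFinset, (gibbsState β K (((w e : ℝ) : ℂ) • Sym2.lift ⟨fun x y =>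
                (((f x : ℝ) : ℂ) - f y) ^ 2 • (spinBond n 0 x y + spinBond n 1 x y),
                  planarBondWeight_symm n fun z => (f z : ℂ)⟩ e)).re)
              ≤ ∑ e ∈ (torusGraph d L).edgeFinset, |w e| * (2 * S ^ 2 *
                Sym2.lift ⟨fun x y => (f x - f y) ^ 2, fun x y => by ring⟩ e) := by
                rw [← Finset.sum_neg_distrib]
                refine Finset.sum_le_sum fun e _ => ?_
                rw [LinearMap.map_smul, smul_eq_mul, Complex.re_ofReal_mul]
                refine (neg_le_abs _).trans ?_
                rw [abs_mul]
                exact mul_le_mul_of_nonneg_left (abs_re_gibbsState_planarBondWeight_le n hK β f e) (abs_nonneg _)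
            _ = 2 * S ^ 2 * E := by
                rw [hEdef, Finset.mul_sum]
                refine Finset.sum_congr rfl fun e _ => ?_
                ring
        · calc ∑ x, (gibbsState β K ((((b x : ℝ) : ℂ) * (((f x : ℝ) : ℂ)) ^ 2) • siteSpin n x α)).re
              ≤ ∑ x, |(gibbsState β K ((((b x : ℝ) : ℂ) * (((f x : ℝ) : ℂ)) ^ 2) • siteSpin n x α)).re| :=
                Finset.sum_le_sum fun x _ => le_abs_self _
            _ ≤ ∑ x, S * (|b x| * (f x) ^ 2) :=
                Finset.sum_le_sum fun x _ => abs_re_gibbsState_field_smul_siteSpin_le n hK β b f x α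
            _ = S * F := by rw [← Finset.mul_sum, hFdef]
  -- Bogoliubov's inequality and assembly
  have hB := bogoliubov_inequality hK hA hC hβ
  have hLHS : (gibbsState β K (siteSpin n o α)).re ^ 2 ≤ ‖gibbsState β K (C * A - A * C)‖ ^ 2 := by
    rw [hCA, LinearMap.map_smul, smul_eq_mul, norm_mul, hu, one_mul]
    have h1 := Complex.abs_re_le_norm (gibbsState β K (siteSpin n o α))
    exact sq_le_sq' (by linarith [neg_abs_le (gibbsState β K (siteSpin n o α)).re]) ((le_abs_self _).trans h1)
  have hDC0 : 0 ≤ (gibbsState β K (C * (K * C - C * K) - (K * C - C * K) * C)).re :=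
    hK.re_gibbsState_doubleComm_nonneg hC hβ
  calc (gibbsState β K (siteSpin n o α)).re ^ 2
      ≤ ‖gibbsState β K (C * A - A * C)‖ ^ 2 := hLHS
    _ ≤ β * (gibbsState β K (A * A)).re *
          (gibbsState β K (C * (K * C - C * K) - (K * C - C * K) * C)).re := hB
    _ ≤ β * S ^ 2 * (gibbsState β K (C * (K * C - C * K) - (K * C - C * K) * C)).re := by
        refine mul_le_mul_of_nonneg_right (mul_le_mul_of_nonneg_left hA2 hβ) hDC0
    _ ≤ β * S ^ 2 * (2 * S ^ 2 * E + S * F) := mul_le_mul_of_nonneg_left hDCle hSβ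

end HeisWeighted

/-! ### §H2 The one-layer harmonic test function: the four estimates -/

section Profile

variable {m : ℕ} (L : ℕ) [NeZero L]

/-- **THE ONE-LAYER HARMONIC TEST FUNCTION AND ITS FOUR ESTIMATES** (the input of every layered Mermin–Wagner bound in this
file): for `m ∈ {1,2}`, `L ≥ 2`, `R ≥ 1` and a site `o` of `(ℤ/Lℤ)^{m+1}`, the function
`f(x) = [x_{last} = o_{last}] · g_R(dist(x,o))`, `g_R(r) = (Σ_{r≤k<R} 1/(k+1))/H_R`, satisfies `f(o) = 1`,
`Σ_x (f_x − f_{x+e_j})² ≤ 16/H_R` for every in-plane direction `j`, `Σ_x (f_x − f_{x+e_{last}})² ≤ 8R²` and `Σ_x f_x² ≤ 4R²`.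
[cite: KleinLandauShucker1981] [cite: MerminWagnerPRL1966, p. 1134] -/
theorem layerHarmonicProfile_estimates (hm1 : 1 ≤ m) (hm2 : m ≤ 2) (hL : 2 ≤ L) {R : ℕ} (hR : 1 ≤ R)
    (o : TorusSite (m + 1) L) :
    layerProfile m L (fun r => (∑ k ∈ Ico r R, (1 : ℝ) / (k + 1)) / ∑ k ∈ range R, (1 : ℝ) / (k + 1)) o o = 1 ∧
      (∀ j : Fin m, ∑ x : TorusSite (m + 1) L,
          (layerProfile m L (fun r => (∑ k ∈ Ico r R, (1 : ℝ) / (k + 1)) / ∑ k ∈ range R, (1 : ℝ) / (k + 1)) o x -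
            layerProfile m L (fun r => (∑ k ∈ Ico r R, (1 : ℝ) / (k + 1)) / ∑ k ∈ range R, (1 : ℝ) / (k + 1)) o
              (x + Pi.single (Fin.castSucc j) 1)) ^ 2 ≤ 16 / ∑ k ∈ range R, (1 : ℝ) / (k + 1)) ∧
      ∑ x : TorusSite (m + 1) L,
          (layerProfile m L (fun r => (∑ k ∈ Ico r R, (1 : ℝ) / (k + 1)) / ∑ k ∈ range R, (1 : ℝ) / (k + 1)) o x -
            layerProfile m L (fun r => (∑ k ∈ Ico r R, (1 : ℝ) / (k + 1)) / ∑ k ∈ range R, (1 : ℝ) / (k + 1)) o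
              (x + Pi.single (Fin.last m) 1)) ^ 2 ≤ 8 * (R : ℝ) ^ 2 ∧
      ∑ x : TorusSite (m + 1) L,
          (layerProfile m L (fun r => (∑ k ∈ Ico r R, (1 : ℝ) / (k + 1)) / ∑ k ∈ range R, (1 : ℝ) / (k + 1)) o x) ^ 2 ≤
        4 * (R : ℝ) ^ 2 := by
  set HR : ℝ := ∑ k ∈ range R, (1 : ℝ) / (k + 1) with hHR
  set g : ℕ → ℝ := fun r => (∑ k ∈ Ico r R, (1 : ℝ) / (k + 1)) / HR with hg
  have hHR0 : 0 < HR := lt_of_lt_of_le one_pos (one_le_sum_range_one_div_succ hR)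
  have hgR : ∀ r, R ≤ r → g r = 0 := fun r hr => harmonicProfile_eq_zero hr
  have hfo : layerProfile m L g o o = 1 := by
    unfold layerProfile
    rw [if_pos rfl, torusDist_self]
    exact harmonicProfile_zero hR
  have hF : ∑ x : TorusSite (m + 1) L, (layerProfile m L g o x) ^ 2 ≤ 4 * (R : ℝ) ^ 2 := by
    rw [sum_sq_layerProfile_eq]
    have h1 := sum_radial_le_sum_range (L := L) hm1 hm2 (Φ := fun r => (g r) ^ 2)
      (fun r => sq_nonneg _) (R := R) (fun r hr => by
        simp only [hgR r hr, ne_eq, OfNat.ofNat_ne_zero, not_false_eq_true, zero_pow]) (Fin.init o)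
    have h2 : ∑ r ∈ range R, 4 * (2 * (r : ℝ) + 1) * (g r) ^ 2 ≤ ∑ r ∈ range R, 4 * (2 * (r : ℝ) + 1) * 1 := by
      refine sum_le_sum fun r _ => mul_le_mul_of_nonneg_left ?_ (by positivity)
      have h0 : 0 ≤ g r := harmonicProfile_nonneg R r
      have h1 : g r ≤ 1 := harmonicProfile_le_one R r
      nlinarith
    have h3 : ∑ r ∈ range R, 4 * (2 * (r : ℝ) + 1) * 1 = 4 * (R : ℝ) ^ 2 := by
      rw [← sum_range_two_mul_cast_add_one R, Finset.mul_sum]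
      refine sum_congr rfl fun r _ => ?_
      ring
    exact h1.trans (h2.trans h3.le)
  refine ⟨hfo, fun j => ?_, ?_, hF⟩
  · refine (sum_sq_sub_inPlane_le (L := L) hL g o j).trans ?_
    have h2 := sum_radial_le_sum_range (L := L) hm1 hm2 (Φ := fun r => (g r - g (r + 1)) ^ 2)
      (fun r => sq_nonneg _) (R := R) (fun r hr => by
        simp only [hgR r hr, hgR (r + 1) (by omega), sub_self, ne_eq, OfNat.ofNat_ne_zero,
          not_false_eq_true, zero_pow]) (Fin.init o)
    have h3 : ∑ r ∈ range R, 4 * (2 * (r : ℝ) + 1) * (g r - g (r + 1)) ^ 2 ≤ 8 / HR :=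
      sum_shell_harmonicProfile_sq_le hR
    calc 2 * ∑ v : TorusSite m L, (g (torusDist v (Fin.init o)) - g (torusDist v (Fin.init o) + 1)) ^ 2
        ≤ 2 * (8 / HR) := mul_le_mul_of_nonneg_left (h2.trans h3) (by norm_num)
      _ = 16 / HR := by ring
  · rw [sum_sq_sub_vertical_eq (L := L) hL g o]
    linarith [hF]

end Profile

/-! ### §H3 The layered Heisenberg antiferromagnet: Mermin–Wagner ceiling on the sourced (staggered) magnetisation -/

section LayeredHeis

variable {m : ℕ} (L : ℕ) [NeZero L] (n : ℕ)

/-- **THE LAYERED MERMIN–WAGNER CEILING FOR THE HEISENBERG ANTIFERROMAGNET (finite volume, uniform in `L`, every field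
direction).** On `(ℤ/Lℤ)^{m+1}`, `m ∈ {1,2}`, `L ≥ 3`, let `H_K = Σ_x Σ_i K_i 𝐒_x·𝐒_{x+e_i}` (`heisAnisoTorus`: in-plane
couplings `K_j`, `j < m`, interlayer coupling `K_m`), `O^α_σ = Σ_x (−1)^{σ(x)} S^α_x` a staggered (or, `σ = 0`, uniform) order
operator in ANY direction `α`, `B` a source strength and `β ≥ 0`. Then for every `R ≥ 1` and every site `o`:
`(Re⟨S^α_o⟩_{β, H_K − B·O^α_σ})² ≤ β S² (2S² (16 (Σ_{j<m}|K_j|)/H_R + 8|K_m| R²) + S|B|·4R²)`, `H_R = Σ_{k<R} 1/(k+1)` —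
the staggered magnetisation that a staggered field induces in weakly coupled Heisenberg layers is
`O(√(β(ΣK_∥/log R + |K_⊥|R²) + |B|R²))` at every scale `R`. [cite: MerminWagnerPRL1966, pp. 1133–1135]
[cite: KleinLandauShucker1981] [cite: KLS1988JSP, eq. (5)] -/
theorem sq_re_gibbsState_siteSpin_le_layeredHeis (hm1 : 1 ≤ m) (hm2 : m ≤ 2) (hL : 3 ≤ L) (K : Fin (m + 1) → ℝ)
    (σ : TorusSite (m + 1) L → ℕ) (α : Fin 3) (B : ℝ) {β : ℝ} (hβ : 0 ≤ β) {R : ℕ} (hR : 1 ≤ R)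
    (o : TorusSite (m + 1) L) :
    (gibbsState β (heisAnisoTorus L n K - (B : ℂ) • XXZKT.stagSpin n σ α) (siteSpin n o α)).re ^ 2 ≤
      β * ((n : ℝ) / 2) ^ 2 *
        (2 * ((n : ℝ) / 2) ^ 2 *
            (16 * (∑ j : Fin m, |K (Fin.castSucc j)|) / (∑ k ∈ range R, (1 : ℝ) / (k + 1)) +
              8 * |K (Fin.last m)| * (R : ℝ) ^ 2) +
          (n : ℝ) / 2 * (|B| * (4 * (R : ℝ) ^ 2))) := by
  set HR : ℝ := ∑ k ∈ range R, (1 : ℝ) / (k + 1) with hHR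
  set g : ℕ → ℝ := fun r => (∑ k ∈ Ico r R, (1 : ℝ) / (k + 1)) / HR with hg
  set f : TorusSite (m + 1) L → ℝ := layerProfile m L g o with hf
  obtain ⟨hfo, hplane, hvert, hF⟩ := layerHarmonicProfile_estimates L hm1 hm2 (by omega) hR o
  rw [← hf] at hfo hplane hvert hF
  have hloc := sq_re_gibbsState_siteSpin_le_heisWeighted L n (dirCoupling L K) (fun x => B * XXZKT.stagSign σ x) α hβ f o hfo
  rw [heisAnisoTorus, XXZKT.smul_stagSpin_eq_sum_field]
  refine hloc.trans ?_
  rw [sum_edgeFinset_abs_dirCoupling_mul_sq_sub L hL K f, Fin.sum_univ_castSucc]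
  have h1 : ∑ j : Fin m, |K (Fin.castSucc j)| *
      ∑ x : TorusSite (m + 1) L, (f x - f (x + Pi.single (Fin.castSucc j) 1)) ^ 2 ≤
      16 * (∑ j : Fin m, |K (Fin.castSucc j)|) / HR := by
    calc ∑ j : Fin m, |K (Fin.castSucc j)| * ∑ x : TorusSite (m + 1) L, (f x - f (x + Pi.single (Fin.castSucc j) 1)) ^ 2
        ≤ ∑ j : Fin m, |K (Fin.castSucc j)| * (16 / HR) :=
          sum_le_sum fun j _ => mul_le_mul_of_nonneg_left (hplane j) (abs_nonneg _)
      _ = 16 * (∑ j : Fin m, |K (Fin.castSucc j)|) / HR := by rw [← Finset.sum_mul]; ring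
  have h2 : |K (Fin.last m)| * ∑ x : TorusSite (m + 1) L, (f x - f (x + Pi.single (Fin.last m) 1)) ^ 2 ≤
      8 * |K (Fin.last m)| * (R : ℝ) ^ 2 :=
    (mul_le_mul_of_nonneg_left hvert (abs_nonneg _)).trans (le_of_eq (by ring))
  have h3 : ∑ x : TorusSite (m + 1) L, |B * XXZKT.stagSign σ x| * (f x) ^ 2 ≤ |B| * (4 * (R : ℝ) ^ 2) := by
    have e : ∀ x : TorusSite (m + 1) L, |B * XXZKT.stagSign σ x| * (f x) ^ 2 = |B| * (f x) ^ 2 := fun x => by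
      rw [abs_mul, XXZKT.abs_stagSign, mul_one]
    rw [Finset.sum_congr rfl fun x _ => e x, ← Finset.mul_sum]
    exact mul_le_mul_of_nonneg_left hF (abs_nonneg _)
  have hS0 : (0 : ℝ) ≤ (n : ℝ) / 2 := by positivity
  exact mul_le_mul_of_nonneg_left (add_le_add (mul_le_mul_of_nonneg_left (add_le_add h1 h2) (by positivity))
    (mul_le_mul_of_nonneg_left h3 hS0)) (mul_nonneg hβ (sq_nonneg _))

/-- **THE THREE-DIMENSIONAL LAYERED HEISENBERG ANTIFERROMAGNET** (in-plane couplings `K₀, K₁`, interlayer `K₂`; `K = (1,1,r)` is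
Kennedy–Lieb–Shastry's model (5), for which the tree PROVES Néel order at low temperature for large spin / by certificate,
`layeredHeis_neelLRO_thermal_largeSpin`, `layeredHeis_neelLRO_of_certificate`): on `(ℤ/Lℤ)³`, `L ≥ 3`, every direction `α`,
staggering `σ`, `β ≥ 0`, `R ≥ 1`: `(Re⟨S^α_o⟩_{β, H_K − B·O^α_σ})² ≤ β S² (2S²(16(|K₀|+|K₁|)/H_R + 8|K₂|R²) + S|B|·4R²)`.
[cite: MerminWagnerPRL1966, pp. 1133–1135] [cite: KleinLandauShucker1981] [cite: KLS1988JSP, eq. (5) and §3] -/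
theorem sq_re_gibbsState_siteSpin_le_layeredHeis_three (hL : 3 ≤ L) (K : Fin 3 → ℝ) (σ : TorusSite 3 L → ℕ)
    (α : Fin 3) (B : ℝ) {β : ℝ} (hβ : 0 ≤ β) {R : ℕ} (hR : 1 ≤ R) (o : TorusSite 3 L) :
    (gibbsState β (heisAnisoTorus L n K - (B : ℂ) • XXZKT.stagSpin n σ α) (siteSpin n o α)).re ^ 2 ≤
      β * ((n : ℝ) / 2) ^ 2 *
        (2 * ((n : ℝ) / 2) ^ 2 *
            (16 * (|K 0| + |K 1|) / (∑ k ∈ range R, (1 : ℝ) / (k + 1)) + 8 * |K 2| * (R : ℝ) ^ 2) +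
          (n : ℝ) / 2 * (|B| * (4 * (R : ℝ) ^ 2))) := by
  have h := sq_re_gibbsState_siteSpin_le_layeredHeis L n (m := 2) (by norm_num) le_rfl hL K σ α B hβ hR o
  simpa only [Fin.sum_univ_two, show Fin.castSucc (0 : Fin 2) = (0 : Fin 3) from rfl,
    show Fin.castSucc (1 : Fin 2) = (1 : Fin 3) from rfl, show Fin.last 2 = (2 : Fin 3) from rfl] using h

end LayeredHeis

/-! ### §H4 Infinite volume: infinitesimal-field (Néel) states of the layered Heisenberg antiferromagnet -/

section HeisInfiniteVolume

variable {m : ℕ} (n : ℕ)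

/-- **MERMIN–WAGNER CEILING FOR THE SOURCED NÉEL STATES OF THE LAYERED HEISENBERG ANTIFERROMAGNET**: every thermodynamic
limit of the Gibbs states of `H_K − B·O^α` (`O^α = Σ_x(−1)^xS^α_x` the Néel order operator of the even torus) along even tori
satisfies `(Re ω(S^α_x))² ≤ β S² (2S²(16 ΣK_∥/H_R + 8|K_⊥|R²) + S|B|·4R²)` at every site, every `R ≥ 1`.
[cite: MerminWagnerPRL1966, pp. 1133–1135] [cite: KomaTasaki1993, §1 (1.8)–(1.9)] -/
theorem layeredHeis_sourcedLimit_sq_re_expect_le (hm1 : 1 ≤ m) (hm2 : m ≤ 2) (K : Fin (m + 1) → ℝ) (α : Fin 3)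
    {β : ℝ} (hβ : 0 ≤ β) (B : ℝ) {ω : InfVolState (m + 1) (n + 1)}
    (h : XXZKT.IsSourcedLimit (fun k => gibbsState β
      (heisAnisoTorus (2 * k + 2) n K - (B : ℂ) • XXZKT.stagSpin n (XXZKT.torusParityExp (m + 1) (2 * k + 2)) α)) ω)
    {R : ℕ} (hR : 1 ≤ R) (x : Site (m + 1)) :
    (ω.expect {x} (XXZKT.siteSpinAt n x α)).re ^ 2 ≤
      β * ((n : ℝ) / 2) ^ 2 *
        (2 * ((n : ℝ) / 2) ^ 2 *
            (16 * (∑ j : Fin m, |K (Fin.castSucc j)|) / (∑ k ∈ range R, (1 : ℝ) / (k + 1)) +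
              8 * |K (Fin.last m)| * (R : ℝ) ^ 2) +
          (n : ℝ) / 2 * (|B| * (4 * (R : ℝ) ^ 2))) :=
  h.sq_re_expect_siteSpinAt_le_of_one_le
    (fun k hk y => sq_re_gibbsState_siteSpin_le_layeredHeis (2 * k + 2) n hm1 hm2 (by omega) K _ α B hβ hR y) x

/-- **MERMIN–WAGNER CEILING FOR THE INFINITESIMAL-FIELD NÉEL STATES OF THE LAYERED HEISENBERG ANTIFERROMAGNET (KT93 (1.8)):**
every `ω̃ = lim_{B↓0} lim_Λ ⟨·⟩_{β, H_K − B·O^α}` has, at every site and for every `R ≥ 1`,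
`(Re ω̃(S^α_x))² ≤ β S² · 2S² (16 ΣK_∥/H_R + 8|K_⊥|R²)` — the spontaneous staggered magnetisation `m_s = (−1)^x Re ω̃(S^α_x)`
(KT93 (1.9)) of weakly coupled Heisenberg layers is `O(√(β/log(1/|K_⊥|)))`: a Néel order parameter of size `m₀` requires
`β ≳ m₀² log(1/|K_⊥|)` — the rigorous content of the estimate `T_N ≲ J/log(J/J_⊥)` for quasi-two-dimensional antiferromagnets
(the parent compounds of the cuprates have `J_⊥/J ∼ 10⁻⁵`). [cite: MerminWagnerPRL1966, pp. 1133–1135]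
[cite: KomaTasaki1993, §1 (1.8)–(1.9)] [cite: KleinLandauShucker1981] -/
theorem layeredHeis_infinitesimalField_sq_re_expect_le (hm1 : 1 ≤ m) (hm2 : m ≤ 2) (K : Fin (m + 1) → ℝ) (α : Fin 3)
    {β : ℝ} (hβ : 0 ≤ β) {ω : InfVolState (m + 1) (n + 1)}
    (h : XXZKT.IsInfinitesimalFieldState (fun B k => gibbsState β
      (heisAnisoTorus (2 * k + 2) n K - (B : ℂ) • XXZKT.stagSpin n (XXZKT.torusParityExp (m + 1) (2 * k + 2)) α)) ω)
    {R : ℕ} (hR : 1 ≤ R) (x : Site (m + 1)) :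
    (ω.expect {x} (XXZKT.siteSpinAt n x α)).re ^ 2 ≤
      β * ((n : ℝ) / 2) ^ 2 * (2 * ((n : ℝ) / 2) ^ 2 *
        (16 * (∑ j : Fin m, |K (Fin.castSucc j)|) / (∑ k ∈ range R, (1 : ℝ) / (k + 1)) +
          8 * |K (Fin.last m)| * (R : ℝ) ^ 2)) := by
  refine XXZKT.IsInfinitesimalFieldState.sq_re_expect_siteSpinAt_le h
    (M₁ := β * ((n : ℝ) / 2) ^ 2 * ((n : ℝ) / 2 * (4 * (R : ℝ) ^ 2))) (fun B hB ω' hω' y => ?_) x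
  have h1 := layeredHeis_sourcedLimit_sq_re_expect_le n hm1 hm2 K α hβ B hω' hR y
  rw [abs_of_pos hB] at h1
  refine h1.trans (le_of_eq ?_)
  ring

/-- **DECOUPLED HEISENBERG LAYERS (`K_⊥ = 0`): NO NÉEL ORDER AT ANY `T > 0`** (Mermin–Wagner's "absence of
antiferromagnetism in one- or two-dimensional isotropic Heisenberg models", recovered as the case `K_⊥ = 0` of the layered
ceiling). [cite: MerminWagnerPRL1966, pp. 1133–1135 (title and main result)] -/
theorem layeredHeis_infinitesimalField_expect_eq_zero_of_decoupled (hm1 : 1 ≤ m) (hm2 : m ≤ 2) (K : Fin (m + 1) → ℝ)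
    (hK : K (Fin.last m) = 0) (α : Fin 3) {β : ℝ} (hβ : 0 ≤ β) {ω : InfVolState (m + 1) (n + 1)}
    (h : XXZKT.IsInfinitesimalFieldState (fun B k => gibbsState β
      (heisAnisoTorus (2 * k + 2) n K - (B : ℂ) • XXZKT.stagSpin n (XXZKT.torusParityExp (m + 1) (2 * k + 2)) α)) ω)
    (x : Site (m + 1)) :
    ω.expect {x} (XXZKT.siteSpinAt n x α) = 0 := by
  set S : ℝ := (n : ℝ) / 2 with hS
  set c : ℝ := β * S ^ 2 * (2 * S ^ 2) * (16 * ∑ j : Fin m, |K (Fin.castSucc j)|) with hc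
  have hc0 : 0 ≤ c := by positivity
  have hsq : ∀ {R : ℕ}, 1 ≤ R →
      (ω.expect {x} (XXZKT.siteSpinAt n x α)).re ^ 2 ≤ c / ∑ k ∈ range R, (1 : ℝ) / (k + 1) := by
    intro R hR
    have h1 := layeredHeis_infinitesimalField_sq_re_expect_le n hm1 hm2 K α hβ h hR x
    rw [hK, abs_zero] at h1
    refine h1.trans (le_of_eq ?_)
    rw [hc, hS]
    ring
  have hre0 : (ω.expect {x} (XXZKT.siteSpinAt n x α)).re ^ 2 ≤ 0 := by
    refine le_of_forall_pos_le_add fun ε hε => ?_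
    obtain ⟨R, hR, hRge⟩ := exists_harmonicSum_ge (c / ε)
    have hH0 : 0 < ∑ k ∈ range R, (1 : ℝ) / (k + 1) := by linarith [one_le_sum_range_one_div_succ hR]
    have hfin : c / ∑ k ∈ range R, (1 : ℝ) / (k + 1) ≤ ε := by
      rw [div_le_iff₀ hH0]
      have := (div_le_iff₀ hε).1 hRge
      linarith
    linarith [hsq hR]
  have hre : (ω.expect {x} (XXZKT.siteSpinAt n x α)).re = 0 :=
    pow_eq_zero_iff (n := 2) (by norm_num) |>.1 (le_antisymm hre0 (sq_nonneg _))
  have him : (ω.expect {x} (XXZKT.siteSpinAt n x α)).im = 0 :=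
    ω.im_expect_eq_zero_of_isHermitian {x} (siteSpin_isHermitian n _ α)
  exact Complex.ext hre him

/-- **THE NÉEL ORDER PARAMETER OF WEAKLY COUPLED HEISENBERG LAYERS VANISHES AS THE LAYERS DECOUPLE, UNIFORMLY** (fixed `β`,
spin, direction and in-plane coupling budget `κ`): for every `ε > 0` there is `δ > 0` such that `Σ_{j<m}|K_j| ≤ κ` and
`|K_⊥| ≤ δ` force `(Re ω̃(S^α_x))² ≤ ε` for every infinitesimal-field Néel state at every site.
[cite: MerminWagnerPRL1966, pp. 1133–1135] [cite: KleinLandauShucker1981] -/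
theorem layeredHeis_infinitesimalField_sq_re_expect_le_of_interlayer_small (hm1 : 1 ≤ m) (hm2 : m ≤ 2) (α : Fin 3)
    {β : ℝ} (hβ : 0 ≤ β) (κ : ℝ) {ε : ℝ} (hε : 0 < ε) :
    ∃ δ : ℝ, 0 < δ ∧ ∀ K : Fin (m + 1) → ℝ, (∑ j : Fin m, |K (Fin.castSucc j)|) ≤ κ → |K (Fin.last m)| ≤ δ →
      ∀ ω : InfVolState (m + 1) (n + 1),
        XXZKT.IsInfinitesimalFieldState (fun B k => gibbsState β
          (heisAnisoTorus (2 * k + 2) n K - (B : ℂ) • XXZKT.stagSpin n (XXZKT.torusParityExp (m + 1) (2 * k + 2)) α)) ω →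
        ∀ x : Site (m + 1), (ω.expect {x} (XXZKT.siteSpinAt n x α)).re ^ 2 ≤ ε := by
  set S : ℝ := (n : ℝ) / 2 with hS
  set c : ℝ := β * S ^ 2 * (2 * S ^ 2) with hc
  have hc0 : 0 ≤ c := by positivity
  obtain ⟨R, hR, hRge⟩ := exists_harmonicSum_ge (32 * c * |κ| / ε)
  set H : ℝ := ∑ k ∈ range R, (1 : ℝ) / (k + 1) with hH
  have hH0 : 0 < H := by linarith [one_le_sum_range_one_div_succ hR]
  refine ⟨ε / (2 * (8 * c * (R : ℝ) ^ 2 + 1)), by positivity, fun K hKpar hKperp ω hω x => ?_⟩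
  have hmain := layeredHeis_infinitesimalField_sq_re_expect_le n hm1 hm2 K α hβ hω hR x
  have hpar0 : 0 ≤ ∑ j : Fin m, |K (Fin.castSucc j)| := Finset.sum_nonneg fun _ _ => abs_nonneg _
  have h1 : c * (16 * (∑ j : Fin m, |K (Fin.castSucc j)|) / H) ≤ ε / 2 := by
    have hκ : (∑ j : Fin m, |K (Fin.castSucc j)|) ≤ |κ| := hKpar.trans (le_abs_self κ)
    have h32 : 32 * c * |κ| ≤ ε * H := by
      have := (div_le_iff₀ hε).1 hRge
      linarith
    rw [mul_div_assoc', div_le_iff₀ hH0]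
    nlinarith [mul_le_mul_of_nonneg_left hκ hc0]
  have h2 : c * (8 * |K (Fin.last m)| * (R : ℝ) ^ 2) ≤ ε / 2 := by
    have hden : 0 < 8 * c * (R : ℝ) ^ 2 + 1 := by positivity
    have hδ : |K (Fin.last m)| * (8 * c * (R : ℝ) ^ 2 + 1) ≤ ε / 2 := by
      have := (le_div_iff₀ (by positivity : (0 : ℝ) < 2 * (8 * c * (R : ℝ) ^ 2 + 1))).1 hKperp
      linarith
    nlinarith [abs_nonneg (K (Fin.last m)), mul_nonneg hc0 (sq_nonneg (R : ℝ))]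
  calc (ω.expect {x} (XXZKT.siteSpinAt n x α)).re ^ 2
      ≤ c * (16 * (∑ j : Fin m, |K (Fin.castSucc j)|) / H + 8 * |K (Fin.last m)| * (R : ℝ) ^ 2) := by
        rw [hc, hS, hH]; exact le_of_le_of_eq hmain (by ring)
    _ = c * (16 * (∑ j : Fin m, |K (Fin.castSucc j)|) / H) + c * (8 * |K (Fin.last m)| * (R : ℝ) ^ 2) := mul_add _ _ _
    _ ≤ ε / 2 + ε / 2 := add_le_add h1 h2
    _ = ε := by ring

/-- **The `1/log` law for weakly coupled Heisenberg layers**: for every `R ≥ 1`,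
`(Re ω̃(S^α_x))² ≤ β S²·2S²(16 ΣK_∥/log(R+1) + 8|K_⊥|R²)` (so `R ≍ |K_⊥|^{-1/4}` gives `O(β S⁴ (ΣK_∥+1)/log(1/|K_⊥|))`).
[cite: MerminWagnerPRL1966, pp. 1133–1135] [cite: KleinLandauShucker1981] -/
theorem layeredHeis_infinitesimalField_sq_re_expect_le_log (hm1 : 1 ≤ m) (hm2 : m ≤ 2) (K : Fin (m + 1) → ℝ) (α : Fin 3)
    {β : ℝ} (hβ : 0 ≤ β) {ω : InfVolState (m + 1) (n + 1)}
    (h : XXZKT.IsInfinitesimalFieldState (fun B k => gibbsState β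
      (heisAnisoTorus (2 * k + 2) n K - (B : ℂ) • XXZKT.stagSpin n (XXZKT.torusParityExp (m + 1) (2 * k + 2)) α)) ω)
    {R : ℕ} (hR : 1 ≤ R) (x : Site (m + 1)) :
    (ω.expect {x} (XXZKT.siteSpinAt n x α)).re ^ 2 ≤
      β * ((n : ℝ) / 2) ^ 2 * (2 * ((n : ℝ) / 2) ^ 2 *
        (16 * (∑ j : Fin m, |K (Fin.castSucc j)|) / Real.log ((R : ℝ) + 1) + 8 * |K (Fin.last m)| * (R : ℝ) ^ 2)) := by
  have h1 := layeredHeis_infinitesimalField_sq_re_expect_le n hm1 hm2 K α hβ h hR x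
  refine h1.trans (mul_le_mul_of_nonneg_left (mul_le_mul_of_nonneg_left (add_le_add ?_ le_rfl) (by positivity))
    (by positivity))
  have hlog : 0 < Real.log ((R : ℝ) + 1) := Real.log_pos (by
    have : (1 : ℝ) ≤ R := by exact_mod_cast hR
    linarith)
  have hpar0 : 0 ≤ 16 * ∑ j : Fin m, |K (Fin.castSucc j)| :=
    mul_nonneg (by norm_num) (Finset.sum_nonneg fun _ _ => abs_nonneg _)
  exact div_le_div_of_nonneg_left hpar0 hlog (log_succ_le_harmonicSum_heis R)

/-- **Infinitesimal-field Néel states of the layered Heisenberg antiferromagnet exist** for every `β`, direction and couplings.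
[cite: KomaTasaki1993, §1 (1.8)] [cite: BratteliRobinsonI1987, Thm. 2.3.15] -/
theorem exists_layeredHeis_infinitesimalFieldState (K : Fin (m + 1) → ℝ) (α : Fin 3) (β : ℝ) :
    ∃ ω : InfVolState (m + 1) (n + 1), XXZKT.IsInfinitesimalFieldState (fun B k => gibbsState β
      (heisAnisoTorus (2 * k + 2) n K - (B : ℂ) • XXZKT.stagSpin n (XXZKT.torusParityExp (m + 1) (2 * k + 2)) α)) ω := by
  have hH : ∀ (B : ℝ) (k : ℕ), (heisAnisoTorus (2 * k + 2) n K -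
      (B : ℂ) • XXZKT.stagSpin n (XXZKT.torusParityExp (m + 1) (2 * k + 2)) α :
      Op (TorusSite (m + 1) (2 * k + 2)) (n + 1)).IsHermitian := by
    intro B k
    rw [XXZKT.smul_stagSpin_eq_sum_field]
    exact (heisAnisoTorus_isHermitian (2 * k + 2) n K).sub (sum_smul_siteSpin_isHermitian n _ α)
  exact XXZKT.exists_isInfinitesimalFieldState _
    (fun B k => gibbsState_one β _ (partitionFn_pos β (hH B k)).ne')
    fun B k X => gibbsState_nonneg_of_posSemidef β (hH B k) (posSemidef_conjTranspose_mul_self X)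

end HeisInfiniteVolume

end Literature.MathematicalPhysics.QuantumLattice

end
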